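import Mathlib
import Summits.ValiantsHypothesis.ValiantsHypothesis.Theses.BarrierLever
import Summits.ValiantsHypothesis.ValiantsHypothesis.Theorems.BarrierLeverPartitionMinorsHitByVPHiddenStatesFullJoinDoor
import Summits.ValiantsHypothesis.ValiantsHypothesis.Theorems.BarrierLeverPartitionMinorsHitByVPHiddenStatesLowerNode

/-!
# Route BarrierLever — item `PartitionMinorsHitByVP` (stmt-ValiantsHypothesis-19717), line `hidden_states`:
# THE FULL-JOIN PAIR NODES (part 2/2): the weakest typed hypothesis of the line, and the one-cube conjecture FJ

Helper file (`--supports stmt-ValiantsHypothesis-19717`; cell valiant-natproofs, rung V4, 𝒟-side door (c), line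
`Cruxes/PartitionMinorsHitByVP/Lines/hidden_states.lean` v8; prover seat val-np-p3 gen 16). Two typed `Prop` nodes (no data,
not asserted) and proved arrows. Closes NO item.

* `Stmt.fullJoinPairLower` — for all large `h` and every PAIR of injective LOWER families of `r` subsets of `Fin h`, SOME wide
  full join (`m ≤ 2h` pieces, `K ≤ h³` states, per-piece tables, piece weights `κ`, state weights `λ`; ALL `2^K` state sets of
  every piece, no threshold family) has a nonsingular block-additive sum. THE WEAKEST hypothesis of the line:
  `fullJoinPairLower_of_pairJoinWideLower` derives it from the registered pair node `LowerNode.Stmt.pairJoinWideLower` (p599518;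
  itself implied by every other registered stub), and `partitionMinorsHitByVP_of_fullJoinPairLower` closes the item from it
  (`b = 12`: the full-join door `FullJoin.partitionMinor_hit_of_fullJoin_mem` of part 1 on lower pairs, then
  `DownCompression.partitionMinorsHitByVP_of_lowerSets`).
* `Stmt.fullJoinCubePairLower` — CONJECTURE FJ of this seat: ONE cube, `K ≤ h` states, the full hidden sum
  `[Σ_{J ⊆ Fin K} λ^J ∏_{a∈u i}(tx none a + Σ_{q∈J} tx (some q) a) ∏_{c∈w j}(ty none c + Σ_{q∈J} ty (some q) c)]_{i,j}` nonsingular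
  for some tables and weights — i.e. the partition matrix of the ORIGINAL one-piece witness of `…HiddenStates` (val-np-p3 g6)
  with NO column selection hits every lower pair. `fullJoinPairLower_of_cube`, `partitionMinorsHitByVP_of_fullJoinCubePairLower`.
  NUMERICAL STATUS (seat lab/fulljoin*.py, lab/startest.py, memo): TRUE for every lower pair at `h ≤ 5` (exhaustive over pairs
  of isomorphism classes with independent generic tables — 2 113 class pairs at `h = 5` — and over all 84 315 pairs
  (class × down-set) with ONE shared table), 0 failures in 1 500 / 150 size-targeted random lower pairs at `h = 6 / 7`
  (`K = h`), and 0 failures on the `h = 6` star-layer families (`{∅} ∪ singletons ∪ a 1-star of 5 pairs`, etc.) on which the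
  graded-colex ONE-SIDED design is singular by `BallDiag.det_eq_zero_of_shadow` (301 partners each). The symmetric choice
  `λ ≡ 1` FAILS already at `h = 3` (square vs star: with the uniform measure on the cube the affine projection of a product of
  two generic linear forms lies in their span — an identity that generic `λ` breaks), so the weights are essential.
  MECHANISM / WHY IT MIGHT BE PROVABLE: `det` is a polynomial in `λ` whose extremal coefficients are `det A[·,S]·det B[·,S]` over
  all linearly separable `S ⊆ {0,1}^K`, `|S| = r`; for every lower pair at `h ≤ 5` SOME separable `S` (depending on the pair) is
  good on both sides (exhaustive), although no FIXED `S` serves all lower families below `2^{h−1}` (shadow obstruction).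
  WHY IT MIGHT FAIL: a lower pair at larger `h` on which every coefficient cancels; none known.

WHAT THIS IS NOT: the nodes are hypotheses, not theorems; item 19717 stays OPEN; nothing on crux 14610 or VP ≠ VNP.
-/

set_option linter.dupNamespace false

namespace Summit.ValiantsHypothesis.ValiantsHypothesis.Theorems.BarrierLever.HiddenStates

open Finset Matrix

noncomputable section

namespace FullJoin

/-! ## 1. The typed nodes -/

/-- **The full-join pair node on lower sets (typed; not asserted).** For all large `h` and every PAIR `(u, w)` of
injective LOWER families of `r` subsets of `Fin h` there are `m ≤ 2h` pieces of `K ≤ h³` hidden states, per-piece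
tables `tx, ty`, piece weights `κ` and state weights `λ` for which the FULL block-additive sum (all `2^K` state sets of
every piece, no threshold family) is a nonsingular `r × r` matrix. The weakest hypothesis of the line: implied by
`LowerNode.Stmt.pairJoinWideLower` (`fullJoinPairLower_of_pairJoinWideLower`). -/
def Stmt.fullJoinPairLower : Prop :=
  ∃ h₁ : ℕ, ∀ h : ℕ, h₁ ≤ h → ∀ (r : ℕ) (u w : Fin r → Finset (Fin h)),
    Function.Injective u → Function.Injective w → IsLowerSet (Set.range u) → IsLowerSet (Set.range w) →
    ∃ (m K : ℕ) (tx ty : Fin m → Option (Fin K) → Fin h → ℂ) (kap : Fin m → ℂ) (lam : Fin m → Fin K → ℂ),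
      m ≤ h + h ∧ K ≤ h * h * h ∧
      (Matrix.of fun i j : Fin r => ∑ p : Fin m, ∑ J : Finset (Fin K), kap p * (∏ k ∈ J, lam p k) *
        ((∏ a ∈ u i, (tx p none a + ∑ q ∈ J, tx p (some q) a)) *
          ∏ c ∈ w j, (ty p none c + ∑ q ∈ J, ty p (some q) c))).det ≠ 0

/-- **The one-cube full-join pair node on lower sets (typed; not asserted) — the seat's conjecture FJ.** ONE hidden cube
with `K ≤ h` states: for all large `h` and every lower pair `(u, w)` of size `r` some tables `tx, ty : Option (Fin K) → Fin h → ℂ`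
and weights `λ` make the full hidden sum `[Σ_{J ⊆ Fin K} λ^J ∏_{a∈u i}(tx none a + Σ_{q∈J} tx (some q) a) ∏_{c∈w j}(ty none c + Σ_{q∈J} ty (some q) c)]_{i,j}`
nonsingular. This is the partition matrix of the original one-piece witness of `…HiddenStates` (val-np-p3 g6) with NO
column selection. Numerical status (this seat): true for every lower pair at `h ≤ 5` (exhaustive), no failure in 1 500
/ 150 sampled lower pairs at `h = 6 / 7` with `K = h`. WHY IT MIGHT FAIL: a lower pair at some larger `h` for which every
coefficient of `det` (a polynomial in `λ`) cancels — none known; the extremal coefficients are `det A[·,S]·det B[·,S]`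
over the linearly separable `S ⊆ {0,1}^K`, and a common good separable `S` exists for every lower pair at `h ≤ 5`. -/
def Stmt.fullJoinCubePairLower : Prop :=
  ∃ h₁ : ℕ, ∀ h : ℕ, h₁ ≤ h → ∀ (r : ℕ) (u w : Fin r → Finset (Fin h)),
    Function.Injective u → Function.Injective w → IsLowerSet (Set.range u) → IsLowerSet (Set.range w) →
    ∃ (K : ℕ) (tx ty : Option (Fin K) → Fin h → ℂ) (lam : Fin K → ℂ), K ≤ h ∧
      (Matrix.of fun i j : Fin r => ∑ J : Finset (Fin K), (∏ k ∈ J, lam k) *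
        ((∏ a ∈ u i, (tx none a + ∑ q ∈ J, tx (some q) a)) *
          ∏ c ∈ w j, (ty none c + ∑ q ∈ J, ty (some q) c))).det ≠ 0

/-! ## 2. Reductions -/

/-- One cube is a wide full join with `m = 1`, `κ = 1`. -/
theorem fullJoinPairLower_of_cube (H : Stmt.fullJoinCubePairLower) : Stmt.fullJoinPairLower := by
  obtain ⟨h₁, H⟩ := H
  refine ⟨max h₁ 1, fun h hh r u w hu hw hlu hlw => ?_⟩
  have hh₁ : h₁ ≤ h := le_trans (le_max_left _ _) hh
  have h1 : 1 ≤ h := le_trans (le_max_right _ _) hh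
  obtain ⟨K, tx, ty, lam, hK, hdet⟩ := H h hh₁ r u w hu hw hlu hlw
  refine ⟨1, K, fun _ => tx, fun _ => ty, fun _ => 1, fun _ => lam, by omega, ?_, ?_⟩
  · calc K ≤ h := hK
      _ = h * 1 * 1 := by ring
      _ ≤ h * h * h := by gcongr
  · have hmat : (Matrix.of fun i j : Fin r => ∑ p : Fin 1, ∑ J : Finset (Fin K),
        (fun _ : Fin 1 => (1 : ℂ)) p * (∏ k ∈ J, (fun _ : Fin 1 => lam) p k) *
        ((∏ a ∈ u i, ((fun _ : Fin 1 => tx) p none a + ∑ q ∈ J, (fun _ : Fin 1 => tx) p (some q) a)) *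
          ∏ c ∈ w j, ((fun _ : Fin 1 => ty) p none c + ∑ q ∈ J, (fun _ : Fin 1 => ty) p (some q) c))) =
        Matrix.of fun i j : Fin r => ∑ J : Finset (Fin K), (∏ k ∈ J, lam k) *
          ((∏ a ∈ u i, (tx none a + ∑ q ∈ J, tx (some q) a)) *
            ∏ c ∈ w j, (ty none c + ∑ q ∈ J, ty (some q) c)) := by
      refine Matrix.ext fun i j => ?_
      simp only [Matrix.of_apply, Fin.sum_univ_one, one_mul]
    rw [hmat]
    exact hdet

/-- **The registered pair node implies the full-join node.** A legal wide threshold design good on both sides gives a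
nonsingular full join: with `κ_p = t₀^{W p}`, `λ_{pk} = t₀^{wt p k}` the design's product `det A[·,e]·det B[·,e]` is the
`t₀`-leading coefficient of the full sum (`exists_eval_det_hiddenSum_ne_zero`). -/
theorem fullJoinPairLower_of_pairJoinWideLower (H : LowerNode.Stmt.pairJoinWideLower) : Stmt.fullJoinPairLower := by
  obtain ⟨h₁, H⟩ := H
  refine ⟨h₁, fun h hh r u w hu hw hlu hlw => ?_⟩
  obtain ⟨m, K, W, wt, e, hm, hK, he, hthr, ⟨tx, hx⟩, ⟨ty, hy⟩⟩ := H h hh r u w hu hw hlu hlw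
  obtain ⟨t₀, ht₀⟩ := fullJoin_det_ne_zero_of_threshold h m K r u w e he W wt hthr tx ty hx hy
  exact ⟨m, K, tx, ty, fun p => t₀ ^ W p, fun p k => t₀ ^ wt p k, hm, hK, ht₀⟩

/-! ## 3. The item from the nodes -/

/-- **The crux from the full-join pair node** (`b = 12`: the class-form door gives `b = 8` on lower pairs, and
`DownCompression.partitionMinorsHitByVP_of_lowerSets` adds `4`). -/
theorem partitionMinorsHitByVP_of_fullJoinPairLower (H : Stmt.fullJoinPairLower) :
    Summit.ValiantsHypothesis.ValiantsHypothesis.Theses.BarrierLever.PartitionMinorsHitByVP := by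
  obtain ⟨h₁, H⟩ := H
  refine DownCompression.partitionMinorsHitByVP_of_lowerSets ⟨8, max h₁ 3, fun h hh r u w hu hw hlu hlw => ?_⟩
  have hh₁ : h₁ ≤ h := le_trans (le_max_left _ _) hh
  have hh3 : 3 ≤ h := le_trans (le_max_right _ _) hh
  obtain ⟨m, K, tx, ty, kap, lam, hm, hK, hdet⟩ := H h hh₁ r u w hu hw hlu hlw
  exact partitionMinor_hit_of_fullJoin_mem h m K r hh3 hm hK u w tx ty kap lam hdet

/-- **The crux from the one-cube full-join conjecture FJ.** -/
theorem partitionMinorsHitByVP_of_fullJoinCubePairLower (H : Stmt.fullJoinCubePairLower) :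
    Summit.ValiantsHypothesis.ValiantsHypothesis.Theses.BarrierLever.PartitionMinorsHitByVP :=
  partitionMinorsHitByVP_of_fullJoinPairLower (fullJoinPairLower_of_cube H)

/-- **The crux from the registered pair node, re-derived through the full join** (sanity check of the reduction chain;
the direct route is `LowerNode.partitionMinorsHitByVP_of_pairJoinWideLower`). -/
theorem partitionMinorsHitByVP_of_pairJoinWideLower' (H : LowerNode.Stmt.pairJoinWideLower) :
    Summit.ValiantsHypothesis.ValiantsHypothesis.Theses.BarrierLever.PartitionMinorsHitByVP :=
  partitionMinorsHitByVP_of_fullJoinPairLower (fullJoinPairLower_of_pairJoinWideLower H)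

end FullJoin

end

end Summit.ValiantsHypothesis.ValiantsHypothesis.Theorems.BarrierLever.HiddenStates

namespace Summit.ValiantsHypothesis.ValiantsHypothesis.Theorems.BarrierLever.HiddenStates

open Finset Matrix

noncomputable section

namespace FullJoin

/-! ## 4. The GENERAL one-cube node (no lower-set hypothesis) — appended by val-np-p3 g16 after the general census -/

/-- **The one-cube full-join node for ALL layouts (typed; not asserted) — conjecture FJ-general.** As `Stmt.fullJoinCubePairLower`
but for EVERY pair of injective families (no lower-set hypothesis): equivalently, the `2^h × 2^h` partition matrix of the one-cube
witness `F_h` (`K ≤ h` states, generic table and weights) is TOTALLY NONSINGULAR. Numerical status (this seat, memo §7): h = 3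
exhaustive over all 12 869 pairs of `r`-subsets of `2^[3]`; 6 000 / 6 000 sampled general pairs at h = 6 / 8 (uniformly random
families, CONCENTRATED families `{C ∪ V}` with a common core, `d`-uniform layers, lower families, mixed; kit j319240/1); the diagonal and
all isomorphic pairs are THEOREMS (`fullJoinCube_diag`, `fullJoinCube_perm`, p673836/p674147). It closes the item DIRECTLY with `b = 8`
(`partitionMinorsHitByVP_of_fullJoinCube`, no down-compression) and implies the lower node (`fullJoinCubePairLower_of_fullJoinCube`).
WHY IT MIGHT FAIL: a layout on which every coefficient of the full hidden sum's determinant cancels; the refuted one-piece THRESHOLD designs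
(CB at h = K = 33, Q*(h³)) are single extremal coefficients and do not bear on it. -/
def Stmt.fullJoinCube : Prop :=
  ∃ h₁ : ℕ, ∀ h : ℕ, h₁ ≤ h → ∀ (r : ℕ) (u w : Fin r → Finset (Fin h)),
    Function.Injective u → Function.Injective w →
    ∃ (K : ℕ) (tx ty : Option (Fin K) → Fin h → ℂ) (lam : Fin K → ℂ), K ≤ h ∧
      (Matrix.of fun i j : Fin r => ∑ J : Finset (Fin K), (∏ k ∈ J, lam k) *
        ((∏ a ∈ u i, (tx none a + ∑ q ∈ J, tx (some q) a)) *
          ∏ c ∈ w j, (ty none c + ∑ q ∈ J, ty (some q) c))).det ≠ 0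

/-- The general node implies the lower-pair node. -/
theorem fullJoinCubePairLower_of_fullJoinCube (H : Stmt.fullJoinCube) : Stmt.fullJoinCubePairLower := by
  obtain ⟨h₁, H⟩ := H
  exact ⟨h₁, fun h hh r u w hu hw _ _ => H h hh r u w hu hw⟩

/-- **The crux from the general one-cube node, DIRECTLY** (`b = 8`, no down-compression): every layout is hit by the truncated one-cube
witness through the full-join door `partitionMinor_hit_of_fullJoin_mem` (p672458). -/
theorem partitionMinorsHitByVP_of_fullJoinCube (H : Stmt.fullJoinCube) :
    Summit.ValiantsHypothesis.ValiantsHypothesis.Theses.BarrierLever.PartitionMinorsHitByVP := by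
  classical
  obtain ⟨h₁, H⟩ := H
  refine ⟨8, max h₁ 3, fun h hh r u w hu hw => ?_⟩
  have hh₁ : h₁ ≤ h := le_trans (le_max_left _ _) hh
  have hh3 : 3 ≤ h := le_trans (le_max_right _ _) hh
  obtain ⟨K, tx, ty, lam, hK, hdet⟩ := H h hh₁ r u w hu hw
  refine partitionMinor_hit_of_fullJoin_mem h 1 K r hh3 (by omega) ?_ u w (fun _ => tx) (fun _ => ty) (fun _ => 1)
    (fun _ => lam) ?_
  · calc K ≤ h := hK
      _ = h * 1 * 1 := by ring
      _ ≤ h * h * h := by gcongr <;> omega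
  · have hmat : (Matrix.of fun i j : Fin r => ∑ p : Fin 1, ∑ J : Finset (Fin K),
        (fun _ : Fin 1 => (1 : ℂ)) p * (∏ k ∈ J, (fun _ : Fin 1 => lam) p k) *
        ((∏ a ∈ u i, ((fun _ : Fin 1 => tx) p none a + ∑ q ∈ J, (fun _ : Fin 1 => tx) p (some q) a)) *
          ∏ c ∈ w j, ((fun _ : Fin 1 => ty) p none c + ∑ q ∈ J, (fun _ : Fin 1 => ty) p (some q) c))) =
        Matrix.of fun i j : Fin r => ∑ J : Finset (Fin K), (∏ k ∈ J, lam k) *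
          ((∏ a ∈ u i, (tx none a + ∑ q ∈ J, tx (some q) a)) *
            ∏ c ∈ w j, (ty none c + ∑ q ∈ J, ty (some q) c)) := by
      refine Matrix.ext fun i j => ?_
      simp only [Matrix.of_apply, Fin.sum_univ_one, one_mul]
    rw [hmat]
    exact hdet

end FullJoin

end

end Summit.ValiantsHypothesis.ValiantsHypothesis.Theorems.BarrierLever.HiddenStates

namespace Summit.ValiantsHypothesis.ValiantsHypothesis.Theorems.BarrierLever.HiddenStates

open Finset Matrix

noncomputable section

namespace FullJoin

/-! ## 5. The WIDE one-cube node (`K ≤ h³` states) — the weakest full-join statement the door accepts; appended by val-np-p3 g16 -/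

/-- **The wide one-cube full-join node (typed; not asserted) — conjecture FJ-wide.** As `Stmt.fullJoinCube` but allowing up to `h³`
states instead of `h`: for every pair of injective families some one-cube block-additive table with `K ≤ h·h·h` states and some weights
make the full hidden sum nonsingular. This is EXACTLY what the door `partitionMinor_hit_of_fullJoin_mem` (p672458, `m = 1`) consumes, so it
still closes the item with `b = 8` (`partitionMinorsHitByVP_of_fullJoinCubeWide`), and it is implied by `Stmt.fullJoinCube`
(`fullJoinCubeWide_of_fullJoinCube`). Its pair-level body is what the kernel theorems of this seat prove for infinite families with MORE
than `h` states: first shells (`h + |X∖Y|`, p677375), two tops (`h + s + 2`, p677930), leaf-peelable tops (`h + s + m`, p679159), the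
unequal cut (`K + 1`, p679314). WHY IT MIGHT FAIL: as for `Stmt.fullJoinCube`; the extra states only help. -/
def Stmt.fullJoinCubeWide : Prop :=
  ∃ h₁ : ℕ, ∀ h : ℕ, h₁ ≤ h → ∀ (r : ℕ) (u w : Fin r → Finset (Fin h)),
    Function.Injective u → Function.Injective w →
    ∃ (K : ℕ) (tx ty : Option (Fin K) → Fin h → ℂ) (lam : Fin K → ℂ), K ≤ h * h * h ∧
      (Matrix.of fun i j : Fin r => ∑ J : Finset (Fin K), (∏ k ∈ J, lam k) *
        ((∏ a ∈ u i, (tx none a + ∑ q ∈ J, tx (some q) a)) *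
          ∏ c ∈ w j, (ty none c + ∑ q ∈ J, ty (some q) c))).det ≠ 0

/-- The `h`-state node implies the wide node. -/
theorem fullJoinCubeWide_of_fullJoinCube (H : Stmt.fullJoinCube) : Stmt.fullJoinCubeWide := by
  obtain ⟨h₁, H⟩ := H
  refine ⟨max h₁ 1, fun h hh r u w hu hw => ?_⟩
  have hh₁ : h₁ ≤ h := le_trans (le_max_left _ _) hh
  have h1 : 1 ≤ h := le_trans (le_max_right _ _) hh
  obtain ⟨K, tx, ty, lam, hK, hdet⟩ := H h hh₁ r u w hu hw
  refine ⟨K, tx, ty, lam, ?_, hdet⟩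
  calc K ≤ h := hK
    _ = h * 1 * 1 := by ring
    _ ≤ h * h * h := by gcongr

/-- **The wide node closes the item** (`b = 8`), through the one-cube door. -/
theorem partitionMinorsHitByVP_of_fullJoinCubeWide (H : Stmt.fullJoinCubeWide) :
    Summit.ValiantsHypothesis.ValiantsHypothesis.Theses.BarrierLever.PartitionMinorsHitByVP := by
  classical
  obtain ⟨h₁, H⟩ := H
  refine ⟨8, max h₁ 3, fun h hh r u w hu hw => ?_⟩
  have hh₁ : h₁ ≤ h := le_trans (le_max_left _ _) hh
  have hh3 : 3 ≤ h := le_trans (le_max_right _ _) hh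
  obtain ⟨K, tx, ty, lam, hK, hdet⟩ := H h hh₁ r u w hu hw
  refine partitionMinor_hit_of_fullJoin_mem h 1 K r hh3 (by omega) hK u w (fun _ => tx) (fun _ => ty) (fun _ => 1)
    (fun _ => lam) ?_
  have hmat : (Matrix.of fun i j : Fin r => ∑ p : Fin 1, ∑ J : Finset (Fin K),
      (fun _ : Fin 1 => (1 : ℂ)) p * (∏ k ∈ J, (fun _ : Fin 1 => lam) p k) *
      ((∏ a ∈ u i, ((fun _ : Fin 1 => tx) p none a + ∑ q ∈ J, (fun _ : Fin 1 => tx) p (some q) a)) *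
        ∏ c ∈ w j, ((fun _ : Fin 1 => ty) p none c + ∑ q ∈ J, (fun _ : Fin 1 => ty) p (some q) c))) =
      Matrix.of fun i j : Fin r => ∑ J : Finset (Fin K), (∏ k ∈ J, lam k) *
        ((∏ a ∈ u i, (tx none a + ∑ q ∈ J, tx (some q) a)) *
          ∏ c ∈ w j, (ty none c + ∑ q ∈ J, ty (some q) c)) := by
    refine Matrix.ext fun i j => ?_
    simp only [Matrix.of_apply, Fin.sum_univ_one, one_mul]
  rw [hmat]
  exact hdet

end FullJoin

end

end Summit.ValiantsHypothesis.ValiantsHypothesis.Theorems.BarrierLever.HiddenStates
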